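import Summits.Ventures.AbcSig.Rows.Statements
import Summits.Ventures.AbcSig.Rows.XnYn29Z2Even

/-!
# Venture AbcSig — CELL bridge for `xⁿ + yⁿ = 29 z²`, `xy` even: p1's census predicate `Rows.C1CellEven 29 11 ∅`

HONEST FRAMING. COMPUTATION cell `pub-abcsig`; CONDITIONAL theorem; no claim on ABC or any summit. Hypotheses exactly
those of `Rows/XnYn29Z2Even.lean` (`row_XnYn29Z2Even`): `BS04Package` (CITED), `DataComplete` /
`Refines` (COMPUTED, certified level files), and the row's per-orbit CITED exclusions `hX_…` universally quantified in
the exponent. Conclusion = the census statement of the SIGNED row of record `census/rows/C1/C1-C29-even.md` in p1's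
vocabulary (`Rows/Statements.lean`): every prime `n ≥ 11`, `n ∤ 29`, no primitive solution with `xy` even.
GENERATED by p-lean gen3/make_c1cell.py (pattern of `Rows/BridgeC1P2.lean`).
-/

namespace Summit.Ventures.AbcSig

/-- `xⁿ + yⁿ = 29z²`, `xy` even, every prime `n ≥ 11` with `n ∤ 29`: p1's `Rows.C1CellEven 29 11 ∅` from `row_XnYn29Z2Even`. -/
theorem C1CellEven_29_of (M : NewformModel) (hP : M.BS04Package)
    (hD1682 : M.DataComplete 1682 level1682Orbits) :
    Rows.C1CellEven 29 11 ∅ :=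
  fun n hn h11 hC _ x y z hpar =>
    row_XnYn29Z2Even M hP hD1682 n hn h11 (by intro hmem; simp only [List.mem_cons, List.not_mem_nil, or_false] at hmem; subst hmem; exact hC (by norm_num)) x y z hpar

end Summit.Ventures.AbcSig
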